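import Literature.MathematicalPhysics.QuantumFieldTheory.BalabanImbrieJaffe1984to88.BIJ88Sect2Statements
import Literature.MathematicalPhysics.QuantumFieldTheory.BalabanImbrieJaffe1984to88.BIJ85Prop522Proof

/-!
# `BalabanImbrieJaffe1984to88.BIJ88Eq215Proof` — T. Bałaban, J. Imbrie, A. Jaffe, *Effective action and cluster properties
of the abelian Higgs model*, Commun. Math. Phys. **114** (1988) 257–315 [BalabanImbrieJaffe1988]: (2.15) p. 261 — the two
expressions of the field-strength form `σ_k = Q^e_k(I − ∂G_{k,Ax}∂*)Q^{e*}_k = Q^e_k(I − ∂𝒟_k∂*)Q^{e*}_k` AGREE, *"the second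
equality following from the change of gauge, (I.5.2.6)"*, PROVED as operator algebra

statement-level skeleton of published theorems with citation tags; proofs where landed; nothing here is a claim about the Yang–Mills mass gap

PDF held: `paper:balaban1988-cmp114-bij-abelian-higgs-effective-action` (journal page = PDF page + 256), p. 261 [PDF 5];
[2] = (I) = [BalabanImbrieJaffe1985] (`paper:balaban1985-cmp97-bij-higgs-minimizers`), (4.2.2) p. 310 [PDF 12], Prop. 5.2.2
(5.2.6) p. 316 [PDF 18], Remark 1 (5.2.10) p. 317 [PDF 19] (text layer, re-read this session).

WHAT IS REPRODUCED.  SKELETON row **C2.Eq2.15** (cell `lit-balaban`; Phase-2 seat p02 gen 2 = unit `lit-balaban-p02`; C2 §§1–4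
fold owner r18, referee ref-5; TAKING line HOME/STATUS.md 2026-08-21T03:47:22Z).  Before this file (2.15) was the bare
`def … : Prop` `BIJ88Sect2Statements.Eq215` (typed p239939), with `BIJ88Sect2Statements.sigmaOp Qe Qes d ds G =
Qe * (1 - d * G * ds) * Qes`.
p. 261, verbatim: *"The operator σ_k gives the quadratic form for the k-th-step field strengths f^{(k)}(p) = (ie_k)^{−1} log u(p).
… Recall from [2] that σ_k = Q^e_k(I − ∂G_{k,Ax}∂*)Q^{e*}_k = Q^e_k(I − ∂𝒟_k∂*)Q^{e*}_k, (2.15) the second equality following from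
the change of gauge, (I.5.2.6)."*  (I) p. 316: *"Proposition 5.2.2. There is a gauge transformation D such that
G_{k,Ax}∂* − 𝒟_k∂* = ∂D. (5.2.6) … Here we write the operator identity, rather than the identity G_{k,Ax}∂*B = 𝒟_k∂*B + ∂DB
for configurations."*; (I) p. 317: *"Remark 1. A consequence of the proposition is ∂G_{k,Ax}∂* = ∂𝒟_k∂*. (5.2.10)"*; (I) p. 310:
*"The right side of (4.2.2) involves the combination ∂G_{k,Ax}∂* which is invariant under a change of gauge. Hence the gauge
chosen to define σ_k is irrelevant"*.

WHAT IS PROVED HERE (0 `sorry`, standard axioms; kind «knitting identity»: the printed one-line argument, kernel-checked).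
§1 IN A RING OF OPERATORS (the typing of record).  `eq5210_ring`: (I.5.2.6) `G_{Ax}∂* − 𝒟∂* = ∂_g D` together with
`∂∂_g = 0` (the curl of a gradient vanishes; `∂_g` = the gradient on gauge functions, a ring element distinct from the `∂` on
bond fields) give (I.5.2.10) `∂G_{Ax}∂* = ∂𝒟∂*`; `eq215_of_5210`: (I.5.2.10) gives **(2.15)** `BIJ88Sect2Statements.Eq215`
for every `Q^e`, `Q^{e*}`; `eq215_of_526` = the composite, i.e. (2.15) exactly as the print derives it; `eq215_iff_of_eq422`:
given (I.4.2.2)'s `Q^eQ^{e*} = η^{−2}I` (`BIJ85Sect4Statements.eq422`), (2.15) ⇔ `Q^e∂G_{Ax}∂*Q^{e*} = Q^e∂𝒟∂*Q^{e*}`.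
§2 DICTIONARY ring ↔ linear maps between DIFFERENT lattices/spaces (the shape of r15's `BIJ85Eq427Proof.eq5210`:
`∂ : A → P_η`, `∂* : P_η → A`, `G, 𝒟 : A → A`, `Q^e : P_η → P₁`, `Q^{e*} : P₁ → P_η`).  A `Slot X V` is a split embedding of a
space `X` in a common carrier `V` (`ι`, `π`, `π ∘ ι = id`; product slots `Slot.inl`/`Slot.inr`, nesting `Slot.comp`), `emb` places
a linear map `X → Y` in the ONE ring `Module.End 𝕜 V`; `emb_mul` (products = compositions), `emb_readback` (nothing is lost).
`sigmaOp_emb`: the ring expression `sigmaOp` of the embedded operators IS the embedded linear map `Q^e ∘ (id − ∂∘G∘∂*) ∘ Q^{e*}`;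
`eq215_emb_iff`: ring-level (2.15) for the embedded operators ⇔ equality of the two linear maps `P₁ → P₁`; `eq5210_lin`
((I.5.2.10) for linear maps over plain modules — r15's `BIJ85Eq427Proof.eq5210` is the inner-product-space copy) and
`eq215_emb_of_526`: (2.15) in `Module.End 𝕜 V` from (I.5.2.6) `h526` and `∂∂_g = 0` `hdd` in linear-map shape.
§3 ON THE CARRIER OF RECORD OF (I.5.2.6) (`BIJ85Sect4Statements.Prop522Data`, where `G_{k,Ax}∂*`, `𝒟_k∂*` are the composed maps
`GaxDs`, `DkDs` on sources): `eq215_prop522` — for any additive curl with curl ∘ grad = 0 and any `Q^e`, `Q^{e*}`, the two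
σ_k maps agree pointwise, from r15's `BIJ85Prop522Proof.eq5210`.
HONEST SCOPE.  (2.15)'s FIRST equality (σ_k defined by the functional integral (I.4.2.1) equals `Q^e(I − ∂G_{Ax}∂*)Q^{e*}`) is
(I.4.2.2), an input here as everywhere in the tree (`h422`-style hypotheses); (I.5.2.6) enters as a hypothesis / as r15's typed
`Prop522` (proved under its printed inputs in `BIJ85Prop522Proof`).  Nothing on the bounds (2.16)–(2.19), on d = 4 or the
continuum; NOT summit progress.
-/

namespace Literature.MathematicalPhysics.QuantumFieldTheory.BalabanImbrieJaffe1984to88.BIJ88Eq215Proof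

open BIJ88Sect2Statements

/-! ## §1  (2.15) in a ring of operators -/

section RingLevel

variable {R : Type*} [Ring R]

/-- `σ_k` depends on the propagator only through the combination `∂G∂*` ((I) p. 310: *"The right side of (4.2.2) involves the
combination ∂G_{k,Ax}∂* which is invariant under a change of gauge"*). [cite: BalabanImbrieJaffe1988, (2.15) p.261] -/
theorem sigmaOp_congr (Qe Qes d ds G G' : R) (h : d * G * ds = d * G' * ds) :
    sigmaOp Qe Qes d ds G = sigmaOp Qe Qes d ds G' := by
  unfold sigmaOp
  rw [h]

/-- **(I.5.2.10) in a ring**: from (I.5.2.6) `G_{Ax}∂* − 𝒟∂* = ∂_g D` (`h526`; `dg` = the gradient ∂ on gauge functions, `Dg` = D)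
and `∂∂_g = 0` (`hdd`, the curl of a gradient vanishes), `∂G_{Ax}∂* = ∂𝒟∂*` — (I) p. 317 *"Remark 1. A consequence of the
proposition is ∂G_{k,Ax}∂* = ∂𝒟_k∂*. (5.2.10)"*. [cite: BalabanImbrieJaffe1985, (5.2.10) p.317] -/
theorem eq5210_ring (d ds GAx Dk dg Dg : R) (h526 : GAx * ds - Dk * ds = dg * Dg) (hdd : d * dg = 0) :
    d * GAx * ds = d * Dk * ds := by
  have h : d * (GAx * ds - Dk * ds) = 0 := by rw [h526, ← mul_assoc, hdd, zero_mul]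
  rw [mul_sub, sub_eq_zero] at h
  simpa only [mul_assoc] using h

/-- **(2.15)** from (I.5.2.10) `∂G_{k,Ax}∂* = ∂𝒟_k∂*`, for every `Q^e_k`, `Q^{e*}_k`. [cite: BalabanImbrieJaffe1988, (2.15) p.261] -/
theorem eq215_of_5210 (Qe Qes d ds GAx Dk : R) (h5210 : d * GAx * ds = d * Dk * ds) : Eq215 Qe Qes d ds GAx Dk :=
  sigmaOp_congr Qe Qes d ds GAx Dk h5210

/-- **(2.15)** p. 261, verbatim: *"σ_k = Q^e_k(I − ∂G_{k,Ax}∂*)Q^{e*}_k = Q^e_k(I − ∂𝒟_k∂*)Q^{e*}_k, (2.15) the second equality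
following from the change of gauge, (I.5.2.6)"* — PROVED in any ring of operators from (I.5.2.6) `G_{k,Ax}∂* − 𝒟_k∂* = ∂D`
(`h526`) and `∂∂ = 0` on gauge functions (`hdd`). [cite: BalabanImbrieJaffe1988, (2.15) p.261] -/
theorem eq215_of_526 (Qe Qes d ds GAx Dk dg Dg : R) (h526 : GAx * ds - Dk * ds = dg * Dg) (hdd : d * dg = 0) :
    Eq215 Qe Qes d ds GAx Dk :=
  eq215_of_5210 Qe Qes d ds GAx Dk (eq5210_ring d ds GAx Dk dg Dg h526 hdd)

/-- With (I.4.2.2)'s input `Q^e_kQ^{e*}_k = η^{−2}I` (`hQ`, any central-free constant `c`; `BIJ85Sect4Statements.eq422`: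
`σ = η^{−2}I − Q^e∂G∂*Q^{e*}`), (2.15) is EQUIVALENT to `Q^e∂G_{Ax}∂*Q^{e*} = Q^e∂𝒟∂*Q^{e*}`. [cite: BalabanImbrieJaffe1988, (2.15) p.261] -/
theorem eq215_iff_of_eq422 (Qe Qes d ds GAx Dk c : R) (hQ : Qe * Qes = c) :
    Eq215 Qe Qes d ds GAx Dk ↔ Qe * d * GAx * ds * Qes = Qe * d * Dk * ds * Qes := by
  unfold Eq215 sigmaOp
  rw [BIJ85Sect4Statements.eq422 Qe Qes d GAx ds c hQ, BIJ85Sect4Statements.eq422 Qe Qes d Dk ds c hQ, sub_right_inj]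

end RingLevel

/-! ## §2  Dictionary: operators between different spaces, placed in one ring `Module.End 𝕜 V` -/

section Dictionary

universe u v w

variable {𝕜 : Type u} [CommRing 𝕜]

/-- plumbing for (2.15): a SPLIT EMBEDDING of a space `X` into a common carrier `V` — inclusion `ι`, projection `π`, `π ∘ ι = id`.
[cite: BalabanImbrieJaffe1988, (2.15) p.261] -/
structure Slot (X : Type v) (V : Type w) [AddCommGroup X] [Module 𝕜 X] [AddCommGroup V] [Module 𝕜 V] where
  /-- inclusion -/
  ι : X →ₗ[𝕜] V
  /-- projection -/
  π : V →ₗ[𝕜] X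
  /-- the embedding is split -/
  πι : π ∘ₗ ι = LinearMap.id

variable {V : Type w} [AddCommGroup V] [Module 𝕜 V]
variable {X Y Z : Type v} [AddCommGroup X] [Module 𝕜 X] [AddCommGroup Y] [Module 𝕜 Y] [AddCommGroup Z] [Module 𝕜 Z]

namespace Slot

/-- plumbing for (2.15): the first factor of a product is a slot. [cite: BalabanImbrieJaffe1988, (2.15) p.261] -/
def inl (X Y : Type v) [AddCommGroup X] [Module 𝕜 X] [AddCommGroup Y] [Module 𝕜 Y] : Slot (𝕜 := 𝕜) X (X × Y) where
  ι := LinearMap.inl 𝕜 X Y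
  π := LinearMap.fst 𝕜 X Y
  πι := LinearMap.fst_comp_inl 𝕜 X Y

/-- plumbing for (2.15): the second factor of a product is a slot. [cite: BalabanImbrieJaffe1988, (2.15) p.261] -/
def inr (X Y : Type v) [AddCommGroup X] [Module 𝕜 X] [AddCommGroup Y] [Module 𝕜 Y] : Slot (𝕜 := 𝕜) Y (X × Y) where
  ι := LinearMap.inr 𝕜 X Y
  π := LinearMap.snd 𝕜 X Y
  πι := LinearMap.snd_comp_inr 𝕜 X Y

/-- plumbing for (2.15): slots nest (a slot of a slot is a slot), so every factor of an iterated product `P₁ × (P_η × (A × G))`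
is a slot. [cite: BalabanImbrieJaffe1988, (2.15) p.261] -/
def comp {W : Type v} [AddCommGroup W] [Module 𝕜 W] (s : Slot (𝕜 := 𝕜) W V) (t : Slot (𝕜 := 𝕜) X W) :
    Slot (𝕜 := 𝕜) X V where
  ι := s.ι ∘ₗ t.ι
  π := t.π ∘ₗ s.π
  πι := by rw [LinearMap.comp_assoc, ← LinearMap.comp_assoc t.ι s.ι s.π, s.πι, LinearMap.id_comp, t.πι]

end Slot

/-- plumbing for (2.15): a linear map `X → Y` between two slotted spaces as an element of the one ring `Module.End 𝕜 V`
(extended by zero off the slot). [cite: BalabanImbrieJaffe1988, (2.15) p.261] -/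
def emb (sY : Slot (𝕜 := 𝕜) Y V) (sX : Slot (𝕜 := 𝕜) X V) (f : X →ₗ[𝕜] Y) : Module.End 𝕜 V := sY.ι ∘ₗ f ∘ₗ sX.π

/-- In the ring, products of embedded operators through a common slot are the embedded COMPOSITIONS.
[cite: BalabanImbrieJaffe1988, (2.15) p.261] -/
theorem emb_mul (sZ : Slot (𝕜 := 𝕜) Z V) (sY : Slot (𝕜 := 𝕜) Y V) (sX : Slot (𝕜 := 𝕜) X V) (g : Y →ₗ[𝕜] Z) (f : X →ₗ[𝕜] Y) :
    emb sZ sY g * emb sY sX f = emb sZ sX (g ∘ₗ f) := by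
  unfold emb
  rw [Module.End.mul_eq_comp]
  simp only [LinearMap.comp_assoc]
  rw [← LinearMap.comp_assoc (f ∘ₗ sX.π) sY.ι sY.π, sY.πι, LinearMap.id_comp]

/-- Differences of embedded operators are embedded differences. [cite: BalabanImbrieJaffe1988, (2.15) p.261] -/
theorem emb_sub (sY : Slot (𝕜 := 𝕜) Y V) (sX : Slot (𝕜 := 𝕜) X V) (f g : X →ₗ[𝕜] Y) :
    emb sY sX f - emb sY sX g = emb sY sX (f - g) := by
  unfold emb
  rw [LinearMap.sub_comp, LinearMap.comp_sub]

/-- Nothing is lost: reading the embedded operator back through the slots returns the linear map.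
[cite: BalabanImbrieJaffe1988, (2.15) p.261] -/
theorem emb_readback (sY : Slot (𝕜 := 𝕜) Y V) (sX : Slot (𝕜 := 𝕜) X V) (f : X →ₗ[𝕜] Y) :
    sY.π ∘ₗ emb sY sX f ∘ₗ sX.ι = f := by
  unfold emb
  rw [← LinearMap.comp_assoc, ← LinearMap.comp_assoc, sY.πι, LinearMap.id_comp, LinearMap.comp_assoc, sX.πι,
    LinearMap.comp_id]

/-- Hence `emb` is injective: an identity in the ring IS the identity of the linear maps. [cite: BalabanImbrieJaffe1988, (2.15) p.261] -/
theorem emb_injective (sY : Slot (𝕜 := 𝕜) Y V) (sX : Slot (𝕜 := 𝕜) X V) : Function.Injective (emb sY sX) := by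
  intro f g h
  rw [← emb_readback sY sX f, ← emb_readback sY sX g, h]

variable {P₁ Pη A : Type v} [AddCommGroup P₁] [Module 𝕜 P₁] [AddCommGroup Pη] [Module 𝕜 Pη] [AddCommGroup A] [Module 𝕜 A]

/-- The ring expression `sigmaOp` ((2.15)) of the embedded operators `Q^e : P_η → P₁`, `Q^{e*} : P₁ → P_η`, `∂ : A → P_η`,
`∂* : P_η → A`, `G : A → A` IS the embedded linear map `Q^e ∘ (id − ∂ ∘ G ∘ ∂*) ∘ Q^{e*} : P₁ → P₁` (the right side of (I.4.2.2)).
[cite: BalabanImbrieJaffe1988, (2.15) p.261] -/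
theorem sigmaOp_emb (s₁ : Slot (𝕜 := 𝕜) P₁ V) (sη : Slot (𝕜 := 𝕜) Pη V) (sA : Slot (𝕜 := 𝕜) A V) (Qek : Pη →ₗ[𝕜] P₁)
    (Qeks : P₁ →ₗ[𝕜] Pη) (dη : A →ₗ[𝕜] Pη) (dηs : Pη →ₗ[𝕜] A) (G : A →ₗ[𝕜] A) :
    sigmaOp (emb s₁ sη Qek) (emb sη s₁ Qeks) (emb sη sA dη) (emb sA sη dηs) (emb sA sA G)
      = emb s₁ s₁ (Qek ∘ₗ (LinearMap.id - dη ∘ₗ G ∘ₗ dηs) ∘ₗ Qeks) := by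
  unfold sigmaOp
  rw [mul_sub, mul_one, sub_mul, emb_mul, emb_mul, emb_mul, emb_mul, emb_mul, emb_sub]
  congr 1
  ext f
  simp [LinearMap.comp_apply]

/-- Ring-level **(2.15)** for the embedded operators ⇔ the two linear maps `P₁ → P₁` (via `G_{k,Ax}` and via `𝒟_k`) coincide.
[cite: BalabanImbrieJaffe1988, (2.15) p.261] -/
theorem eq215_emb_iff (s₁ : Slot (𝕜 := 𝕜) P₁ V) (sη : Slot (𝕜 := 𝕜) Pη V) (sA : Slot (𝕜 := 𝕜) A V) (Qek : Pη →ₗ[𝕜] P₁)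
    (Qeks : P₁ →ₗ[𝕜] Pη) (dη : A →ₗ[𝕜] Pη) (dηs : Pη →ₗ[𝕜] A) (GAx Dk : A →ₗ[𝕜] A) :
    Eq215 (emb s₁ sη Qek) (emb sη s₁ Qeks) (emb sη sA dη) (emb sA sη dηs) (emb sA sA GAx) (emb sA sA Dk) ↔
      Qek ∘ₗ (LinearMap.id - dη ∘ₗ GAx ∘ₗ dηs) ∘ₗ Qeks = Qek ∘ₗ (LinearMap.id - dη ∘ₗ Dk ∘ₗ dηs) ∘ₗ Qeks := by
  unfold Eq215
  rw [sigmaOp_emb, sigmaOp_emb]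
  exact (emb_injective s₁ s₁).eq_iff

/-- **(I.5.2.10) for linear maps** (plain modules; `BIJ85Eq427Proof.eq5210` is the inner-product-space copy): from (I.5.2.6)
`G_{k,Ax}∂*J − 𝒟_k∂*J = ∂(DJ)` (`h526`) and `∂ ∘ ∂_g = 0` (`hdd`), `∂ ∘ G_{k,Ax} ∘ ∂* = ∂ ∘ 𝒟_k ∘ ∂*`.
[cite: BalabanImbrieJaffe1985, (5.2.10) p.317] -/
theorem eq5210_lin {Gf : Type*} [AddCommGroup Gf] [Module 𝕜 Gf] (dη : A →ₗ[𝕜] Pη) (dηs : Pη →ₗ[𝕜] A)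
    (GAx Dk : A →ₗ[𝕜] A) (dg : Gf →ₗ[𝕜] A) (Dg : Pη →ₗ[𝕜] Gf) (h526 : ∀ J : Pη, GAx (dηs J) - Dk (dηs J) = dg (Dg J))
    (hdd : dη ∘ₗ dg = 0) : dη ∘ₗ GAx ∘ₗ dηs = dη ∘ₗ Dk ∘ₗ dηs := by
  ext J
  have h0 : dη (dg (Dg J)) = 0 := by simpa using LinearMap.congr_fun hdd (Dg J)
  have h : dη (GAx (dηs J)) - dη (Dk (dηs J)) = 0 := by rw [← map_sub, h526, h0]
  simpa [LinearMap.comp_apply] using sub_eq_zero.mp h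

/-- **(2.15)** in the one ring `Module.End 𝕜 V` for operators between different spaces, from (I.5.2.10) in linear-map shape.
[cite: BalabanImbrieJaffe1988, (2.15) p.261] -/
theorem eq215_emb (s₁ : Slot (𝕜 := 𝕜) P₁ V) (sη : Slot (𝕜 := 𝕜) Pη V) (sA : Slot (𝕜 := 𝕜) A V) (Qek : Pη →ₗ[𝕜] P₁)
    (Qeks : P₁ →ₗ[𝕜] Pη) (dη : A →ₗ[𝕜] Pη) (dηs : Pη →ₗ[𝕜] A) (GAx Dk : A →ₗ[𝕜] A)
    (h5210 : dη ∘ₗ GAx ∘ₗ dηs = dη ∘ₗ Dk ∘ₗ dηs) :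
    Eq215 (emb s₁ sη Qek) (emb sη s₁ Qeks) (emb sη sA dη) (emb sA sη dηs) (emb sA sA GAx) (emb sA sA Dk) := by
  rw [eq215_emb_iff, h5210]

/-- **(2.15)** in the one ring `Module.End 𝕜 V`, exactly as printed: from (I.5.2.6) (`h526`) and `∂∂ = 0` (`hdd`) in linear-map
shape (the hypotheses of `BIJ85Eq427Proof.eq5210`). [cite: BalabanImbrieJaffe1988, (2.15) p.261] -/
theorem eq215_emb_of_526 {Gf : Type*} [AddCommGroup Gf] [Module 𝕜 Gf] (s₁ : Slot (𝕜 := 𝕜) P₁ V) (sη : Slot (𝕜 := 𝕜) Pη V)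
    (sA : Slot (𝕜 := 𝕜) A V) (Qek : Pη →ₗ[𝕜] P₁) (Qeks : P₁ →ₗ[𝕜] Pη) (dη : A →ₗ[𝕜] Pη) (dηs : Pη →ₗ[𝕜] A)
    (GAx Dk : A →ₗ[𝕜] A) (dg : Gf →ₗ[𝕜] A) (Dg : Pη →ₗ[𝕜] Gf)
    (h526 : ∀ J : Pη, GAx (dηs J) - Dk (dηs J) = dg (Dg J)) (hdd : dη ∘ₗ dg = 0) :
    Eq215 (emb s₁ sη Qek) (emb sη s₁ Qeks) (emb sη sA dη) (emb sA sη dηs) (emb sA sA GAx) (emb sA sA Dk) :=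
  eq215_emb s₁ sη sA Qek Qeks dη dηs GAx Dk (eq5210_lin dη dηs GAx Dk dg Dg h526 hdd)

end Dictionary

/-! ## §3  On the carrier of record of (I.5.2.6) -/

/-- **(2.15) on `BIJ85Sect4Statements.Prop522Data`** (r15's carrier of Prop. I.5.2.2, where `G_{k,Ax}∂*` and `𝒟_k∂*` are the
composed maps `GaxDs`, `DkDs` on sources): if (I.5.2.6) holds (`h522 : P.Prop522`, proved under its printed inputs by
`BIJ85Prop522Proof.prop522_holds`), then for every additive curl `∂` with `∂ ∘ grad = 0` and every `Q^e_k`, `Q^{e*}_k` the two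
σ_k maps `f ↦ Q^e(Q^{e*}f − ∂G_{k,Ax}∂*Q^{e*}f)` and `f ↦ Q^e(Q^{e*}f − ∂𝒟_k∂*Q^{e*}f)` coincide — by r15's (I.5.2.10)
`BIJ85Prop522Proof.eq5210`. [cite: BalabanImbrieJaffe1988, (2.15) p.261] -/
theorem eq215_prop522 (P : BIJ85Sect4Statements.Prop522Data) {P₁ : Type*} (curl : P.Field →+ P.Field)
    (hcurl_grad : ∀ μ : P.Gauge, curl (P.grad μ) = 0) (h522 : P.Prop522) (Qek : P.Field → P₁) (Qeks : P₁ → P.Field) :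
    (fun f => Qek (Qeks f - curl (P.GaxDs (Qeks f)))) = fun f => Qek (Qeks f - curl (P.DkDs (Qeks f))) := by
  funext f
  rw [BIJ85Prop522Proof.eq5210 P curl hcurl_grad h522 (Qeks f)]

end Literature.MathematicalPhysics.QuantumFieldTheory.BalabanImbrieJaffe1984to88.BIJ88Eq215Proof
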